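import Summits.CriticalPhenomena.PercolationContinuityZ3.Theorems.PercNearOneGluingNoHeavyQuantHairCherryCombRow
import Summits.CriticalPhenomena.PercolationContinuityZ3.Theorems.PercNearOneGluingNoHeavyQuantFarTreeCherryComb
import HarnessLib

/-!
# QUANT lane R8, FAR on trees beyond block-combs: the hair–cherry-comb row in GATE COORDINATES

builds on p205010 (kernel theorem, internal audit signed; external expert review pending)

Support file (`--supports stmt-CriticalPhenomena-4575`), QUANT lane seat prim-quant-p1 (gen 10); memo `run/shared/lean/prim/quant/P1-SURPLUS.md` §21.
Theorems only, no sorries, standard axioms.  The identification `Quant.CherryCombGate.real_heavy_eq_tailSt` (`…QuantFarTreeCherryComb.lean`, same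
seat) composed with `Quant.CherryComb.tail_ge_of_hairCherryComb` (`…QuantHairCherryCombRow.lean`).

* `Quant.CherryCombGate.farTree_hairCherryComb_of_mean` — **gate coordinates**: independent gates `q : E → [0,1]`, chain `ch` (injective), pieces
  with pairwise disjoint private gate sets `G k` off the chain, levels `lv k ≤ D`, class sizes `a k`, stems `st` (stemless, at the level of their
  leaves); every leaf `k` is in a unit cherry (`a (st k) = 0`, one partner leaf of the same size) or is the unique live leaf of a LIGHT hair
  (`0 < a (st k)`, `(∏_{G(st k)} q)·(a (st k) + (∏_{G k} q)·a k) ≤ a (st k)`).  Piece `k` is reached when the chain prefix of length `lv k`, `G k` and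
  `G (st k)` are open, contributing `a k` relays.  If `2j < Σ_k a k·marginal k` and `1 − marginal k ≤ t` on live pieces then `P(Σ_{reached} a k ≤ j) ≤ t`.
  In `Quant.FarTreeRow`'s language (glued classes = equal ancestor sets): FAR at every layer for every rooted forest of glued classes whose side
  structures off the distinguished chain are blocks, unit cherries / unit two-relay hairs, and two-class hairs `(p relays; r more below)` with
  `s(p + cr) ≤ p`.  The route-vocabulary form for honest trees (class sizes `≤ 1`) is already `Quant.farRelayRow_tree_cherryComb`.
[this work]; product measure [cite: Grimmett1999, §1.3 p. 10].
-/

noncomputable section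

namespace Summit.CriticalPhenomena.PercolationContinuityZ3.Theorems

namespace Quant

namespace CherryCombGate

open Finset MeasureTheory
open Literature.Probability.LatticeModels
open Literature.Probability.Percolation
open scoped Classical

variable {E : Type*} [Fintype E] [DecidableEq E] {κ : Type*} [Fintype κ] [DecidableEq κ]

/-- product weight of a set of open pieces -/
local notation3 "wt[" g ", " S "]" => ∏ k, (if k ∈ (S : Finset κ) then (g : κ → ℝ) k else 1 - (g : κ → ℝ) k)
/-- depth law of the chain -/
local notation3 "pd[" D ", " q ", " i "]" =>
  (∏ i' ∈ Finset.range (i : ℕ), (q : ℕ → ℝ) i') * (if (i : ℕ) < (D : ℕ) then 1 - (q : ℕ → ℝ) i else 1)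
/-- mass counted at depth `i`, stemmed model -/
local notation3 "massSt[" lv ", " a ", " st ", " i ", " S "]" =>
  ∑ k ∈ (S : Finset κ).filter (fun k => (lv : κ → ℕ) k ≤ (i : ℕ) ∧ (st : κ → κ) k ∈ (S : Finset κ)), ((a : κ → ℕ) k : ℕ)
/-- the stemmed tail -/
local notation3 "TAILst[" D ", " q ", " lv ", " a ", " g ", " st ", " j "]" =>
  ∑ i ∈ Finset.range ((D : ℕ) + 1), pd[D, q, i] *
    ∑ S : Finset κ, wt[g, S] * (if (j : ℕ) + 1 ≤ massSt[lv, a, st, i, S] then (1 : ℝ) else 0)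

/-- **THE HAIR–CHERRY-COMB ROW, gate coordinates.**  See the module docstring. [this work] -/
theorem farTree_hairCherryComb_of_mean (q : E → unitInterval) (D : ℕ) (ch : Fin D → E) (hch : Function.Injective ch)
    (G : κ → Finset E) (hGdisj : ∀ k k', k ≠ k' → Disjoint (G k) (G k')) (hGch : ∀ k (i : Fin D), ch i ∉ G k)
    (lv : κ → ℕ) (hlv : ∀ k, lv k ≤ D) (a : κ → ℕ) (st : κ → κ) (hstem : ∀ k, st (st k) = st k)
    (hlvst : ∀ k, lv (st k) = lv k)
    (hunit : ∀ k, st k ≠ k →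
      (a (st k) = 0 ∧ ∃ k', k' ≠ k ∧ k' ≠ st k ∧ st k' = st k ∧ a k' = a k ∧
        ∀ k'', st k'' = st k → k'' = st k ∨ k'' = k ∨ k'' = k') ∨
      (0 < a (st k) ∧ 0 < a k ∧ (∏ e ∈ G (st k), (q e : ℝ)) * (a (st k) + (∏ e ∈ G k, (q e : ℝ)) * a k) ≤ a (st k) ∧
        ∀ k'', st k'' = st k → k'' = st k ∨ k'' = k))
    (j : ℕ) (t : ℝ)
    (hmean : (2 * j : ℝ) < ∑ k, (a k : ℝ) *
      ((∏ i ∈ Finset.range (lv k), (if h : i < D then ((q (ch ⟨i, h⟩) : unitInterval) : ℝ) else 1)) *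
        (if st k = k then ∏ e ∈ G k, (q e : ℝ) else (∏ e ∈ G (st k), (q e : ℝ)) * ∏ e ∈ G k, (q e : ℝ))))
    (ht : ∀ k, 0 < a k →
      1 - (∏ i ∈ Finset.range (lv k), (if h : i < D then ((q (ch ⟨i, h⟩) : unitInterval) : ℝ) else 1)) *
        (if st k = k then ∏ e ∈ G k, (q e : ℝ) else (∏ e ∈ G (st k), (q e : ℝ)) * ∏ e ∈ G k, (q e : ℝ)) ≤ t) :
    (prodBernoulli q).real {ω : Set E | ∑ k ∈ Finset.univ.filter
        (fun k => (∀ i : Fin D, (i : ℕ) < lv k → ch i ∈ ω) ∧ ((G k : Finset E) : Set E) ⊆ ω ∧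
          ((G (st k) : Finset E) : Set E) ⊆ ω), a k ≤ j} ≤ t := by
  set H : Set (Set E) := {ω : Set E | j + 1 ≤ ∑ k ∈ Finset.univ.filter
        (fun k => (∀ i : Fin D, (i : ℕ) < lv k → ch i ∈ ω) ∧ ((G k : Finset E) : Set E) ⊆ ω ∧
          ((G (st k) : Finset E) : Set E) ⊆ ω), a k} with hH
  have hcompl : {ω : Set E | ∑ k ∈ Finset.univ.filter
        (fun k => (∀ i : Fin D, (i : ℕ) < lv k → ch i ∈ ω) ∧ ((G k : Finset E) : Set E) ⊆ ω ∧
          ((G (st k) : Finset E) : Set E) ⊆ ω), a k ≤ j} = Hᶜ := by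
    ext ω; simp only [hH, Set.mem_setOf_eq, Set.mem_compl_iff, not_le]; omega
  have hheavy : (prodBernoulli q).real H =
      TAILst[D, (fun i => if h : i < D then ((q (ch ⟨i, h⟩) : unitInterval) : ℝ) else 1), lv, a,
        (fun k => ∏ e ∈ G k, (q e : ℝ)), st, j] :=
    real_heavy_eq_tailSt D q ch hch G hGdisj hGch lv hlv a st j
  rw [hcompl, probReal_compl_eq_one_sub MeasurableSet.of_discrete, hheavy]
  set qc : ℕ → ℝ := fun i => if h : i < D then ((q (ch ⟨i, h⟩) : unitInterval) : ℝ) else 1 with hqc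
  set g : κ → ℝ := fun k => ∏ e ∈ G k, (q e : ℝ) with hg
  have hqc01 : ∀ i, 0 ≤ qc i ∧ qc i ≤ 1 := fun i => by
    by_cases h : i < D
    · simp only [hqc, dif_pos h]; exact ⟨(q _).2.1, (q _).2.2⟩
    · simp only [hqc, dif_neg h]; norm_num
  have hg01 : ∀ k, 0 ≤ g k ∧ g k ≤ 1 := fun k =>
    ⟨Finset.prod_nonneg fun e _ => (q e).2.1, Finset.prod_le_one (fun e _ => (q e).2.1) fun e _ => (q e).2.2⟩
  have hx : ∀ k, 0 < a k → 1 - t ≤ (∏ i ∈ Finset.range (lv k), qc i) * (if st k = k then g k else g (st k) * g k) :=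
    fun k hk => by have := ht k hk; linarith
  have key := CherryComb.tail_ge_of_hairCherryComb D qc hqc01 lv a g hg01 st hstem hlvst hunit j (fun k _ => hlv k) (1 - t) hx hmean
  linarith

end CherryCombGate

end Quant

end Summit.CriticalPhenomena.PercolationContinuityZ3.Theorems
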